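import Summits.HubbardSuperconductivity.HubbardSuperconductivity.Theorems.WidthHaldaneDualExact

/-!
# `WidthHaldaneBridge` (stmt-HubbardSuperconductivity-16311), negative side: the energy-dual /
# frustration-cost form of the crux carries no freedom in the coupling

Round-1 crux ideation (cards `pair-repulsion-dual`, `frustration-cost-duality`) transferred the
crux to its ENERGY DUAL — for every admissible tube and displacement, SOME coupling `h > 0` at
which the repulsive column pair source `h·X_r` (resp. `ν·J_r`, `J_r = X_r/2`) raises the
`(N_{L,M}(δ), S^z = 0)` sector minimum by at least `h·2·floor` — advertising as its why-easier
that the dual has "no eigenvector quantifier: spectral edges only, two-sided min–max / certificate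
tools at finite coupling". `Theorems/WidthHaldaneDualExact.lean` already certifies that the dual
is EQUIVALENT to the crux (`widthHaldaneBridge_iff_dualBridge`). This file records WHY the
existential over the coupling buys nothing (crux-triage r1, triager 2):

* `cost_floor_antitone` — for Hermitian `H`, `Y` and a sector `K ≠ ⊥`, the map
  `h ↦ minEnergyOn (H + h•Y) K` is a minimum of affine functions of `h`, hence a cost floor
  `minEnergyOn H K + h·F ≤ minEnergyOn (H + h•Y) K` at ONE coupling `h > 0` holds at EVERY coupling
  `0 < h' ≤ h`;
* `cost_floor_small_coupling` — so an admissible coupling may always be taken below any prescribed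
  `h₀ > 0`: the dual law is a statement about `h → 0⁺`, i.e. about the right-derivative
  `∂ₕ⁺ minEnergyOn (H + h•Y) K |₀`, which in finite dimension is the minimum of `Re⟨ψ, Yψ⟩` over
  the unit ground vectors of `H` in `K` (degenerate first-order perturbation theory) — exactly the
  ground-multiplet (eigenvector) statement the transfer set out to remove;
* `tube_dualCost_small_coupling` — the same on the crux's tube `tubeH0 L M Λ e U` and sector
  `szSector (tubeFilling L M δ) 0` (`δ ≥ -1`), for an arbitrary Hermitian source.

Sources: T. Kato, *Perturbation Theory for Linear Operators* (1966) II-§6.1 (first-order splitting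
of a degenerate eigenvalue); H. Tasaki, *Physics and Mathematics of Quantum Many-Body Systems*
(2020) §2.2 (variational characterisation of sector minima). No definitions are introduced.
REUSED: `le_minEnergyOn_of_forall_form`, `re_form_add_real_smul`, `szSector_tubeFilling_ne_bot`
(WidthHaldaneDualExact), `minEnergyOn_mul_le_re_rayleigh` (Literature
SectorGroundProjContinuity), `re_star_dotProduct_self_nonneg` (Literature
SectorEigenvalueContinuation), `isHermitian_tubeH0` (WidthHaldaneTubeKinematics).
-/

noncomputable section

namespace Summit.HubbardSuperconductivity.HubbardSuperconductivity.Theorems.WidthHaldaneBridge.Negative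

set_option linter.dupNamespace false -- summit = problem name (single-conjunct summit), D-0017

open scoped Matrix ComplexConjugate
open Matrix Literature.MathematicalPhysics.QuantumLattice
  Literature.MathematicalPhysics.QuantumLattice.EigenvalueContinuation
open Summit.HubbardSuperconductivity.HubbardSuperconductivity.Theorems.WidthHaldane

/-! ### Generic: cost floors of a Hermitian pencil on a sector are inherited by smaller couplings -/

section Generic

variable {ι : Type*} [Fintype ι]

/-- **Cost floors are inherited by smaller couplings.** For Hermitian `H`, `Y`, a sector `K ≠ ⊥`
and any `F`: if `minEnergyOn H K + h·F ≤ minEnergyOn (H + h•Y) K` at one coupling `h ≥ h' > 0`,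
then also `minEnergyOn H K + h'·F ≤ minEnergyOn (H + h'•Y) K` (concavity of the sector minimum in
the coupling: `H + h'•Y` is the convex combination `(1 - h'/h)·H + (h'/h)·(H + h•Y)` of quadratic
forms). [folklore] -/
theorem cost_floor_antitone {H Y : Matrix ι ι ℂ} (hH : H.IsHermitian) (hY : Y.IsHermitian)
    (K : Submodule ℂ (ι → ℂ)) (hK : K ≠ ⊥) {F h h' : ℝ} (hh' : 0 < h') (hle : h' ≤ h)
    (hcost : H.minEnergyOn K + h * F ≤ (H + h • Y).minEnergyOn K) :
    H.minEnergyOn K + h' * F ≤ (H + h' • Y).minEnergyOn K := by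
  have hh : 0 < h := hh'.trans_le hle
  have hHY : (H + h • Y).IsHermitian := hH.add (hY.smul (IsSelfAdjoint.all h))
  refine le_minEnergyOn_of_forall_form _ K hK fun v hv => ?_
  have h1 := minEnergyOn_mul_le_re_rayleigh hH K hv
  have h2 := minEnergyOn_mul_le_re_rayleigh hHY K hv
  rw [re_form_add_real_smul] at h2 ⊢
  have hn : 0 ≤ (star v ⬝ᵥ v).re := re_star_dotProduct_self_nonneg v
  set n : ℝ := (star v ⬝ᵥ v).re with hn_def
  set a : ℝ := (star v ⬝ᵥ H *ᵥ v).re with ha_def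
  set y : ℝ := (star v ⬝ᵥ Y *ᵥ v).re with hy_def
  set E₀ : ℝ := H.minEnergyOn K with hE₀
  set Eh : ℝ := (H + h • Y).minEnergyOn K with hEh
  -- h1 : E₀·n ≤ a;  h2 : Eh·n ≤ a + h·y;  hcost : E₀ + h·F ≤ Eh.
  have key : h * ((E₀ + h' * F) * n) ≤ h * (a + h' * y) := by
    have e1 : h * ((E₀ + h' * F) * n) = (h - h') * (E₀ * n) + h' * ((E₀ + h * F) * n) := by ring
    have e2 : h * (a + h' * y) = (h - h') * a + h' * (a + h * y) := by ring
    rw [e1, e2]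
    have hsub : 0 ≤ h - h' := sub_nonneg.2 hle
    have h3 : (E₀ + h * F) * n ≤ Eh * n := mul_le_mul_of_nonneg_right hcost hn
    nlinarith [mul_le_mul_of_nonneg_left h1 hsub, mul_le_mul_of_nonneg_left (h3.trans h2) hh'.le]
  exact le_of_mul_le_mul_left key hh

/-- **The dual law is decided at `h → 0⁺`.** If some coupling `h > 0` carries the cost floor
`minEnergyOn H K + h·F ≤ minEnergyOn (H + h•Y) K`, then for every `h₀ > 0` some coupling
`0 < h ≤ h₀` does. [folklore] -/
theorem cost_floor_small_coupling {H Y : Matrix ι ι ℂ} (hH : H.IsHermitian) (hY : Y.IsHermitian)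
    (K : Submodule ℂ (ι → ℂ)) (hK : K ≠ ⊥) {F : ℝ}
    (hex : ∃ h : ℝ, 0 < h ∧ H.minEnergyOn K + h * F ≤ (H + h • Y).minEnergyOn K)
    {h₀ : ℝ} (hh₀ : 0 < h₀) :
    ∃ h : ℝ, 0 < h ∧ h ≤ h₀ ∧ H.minEnergyOn K + h * F ≤ (H + h • Y).minEnergyOn K := by
  obtain ⟨h, hh, hcost⟩ := hex
  exact ⟨min h h₀, lt_min hh hh₀, min_le_right _ _,
    cost_floor_antitone hH hY K hK (lt_min hh hh₀) (min_le_left _ _) hcost⟩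

end Generic

/-! ### On the crux's tubes -/

section Tube

variable (L M : ℕ) [NeZero L] [NeZero M] (Λ : Type) [LinearOrder Λ] [Fintype Λ]
  (e : Λ ≃ ZMod L × ZMod M)

/-- **On the tube**: for the pure Hubbard tube `tubeH0 L M Λ e U`, the cruxes' sector
`(N_{L,M}(δ), S^z = 0)` (`δ ≥ -1`, so the sector is non-trivial) and ANY Hermitian source `Y`
(e.g. the column pair source `X_r` of `widthHaldaneBridge_iff_dualBridge`, or `J_r = X_r/2`), a
cost floor `E₀ + h·F ≤ E(tubeH0 + h•Y)` at some coupling `h > 0` already holds at couplings below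
any prescribed `h₀ > 0`: the energy-dual form of the crux is a first-order (ground-multiplet)
statement. [folklore] -/
theorem tube_dualCost_small_coupling (U : ℝ) {δ : ℝ} (hδ : -1 ≤ δ)
    {Y : Matrix (Finset (Orb Λ)) (Finset (Orb Λ)) ℂ} (hY : Y.IsHermitian) {F : ℝ}
    (hex : ∃ h : ℝ, 0 < h ∧
      (tubeH0 L M Λ e U).minEnergyOn (szSector (tubeFilling L M δ) 0) + h * F ≤
        (tubeH0 L M Λ e U + h • Y).minEnergyOn (szSector (tubeFilling L M δ) 0))
    {h₀ : ℝ} (hh₀ : 0 < h₀) :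
    ∃ h : ℝ, 0 < h ∧ h ≤ h₀ ∧
      (tubeH0 L M Λ e U).minEnergyOn (szSector (tubeFilling L M δ) 0) + h * F ≤
        (tubeH0 L M Λ e U + h • Y).minEnergyOn (szSector (tubeFilling L M δ) 0) :=
  cost_floor_small_coupling (isHermitian_tubeH0 L M Λ e U) hY _
    (szSector_tubeFilling_ne_bot L M Λ e U hδ) hex hh₀

end Tube

end Summit.HubbardSuperconductivity.HubbardSuperconductivity.Theorems.WidthHaldaneBridge.Negative

end
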